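import Literature.Topology.FourManifolds.SurgeryTraceTop
import Literature.Topology.FourManifolds.BordismOrientedMerging
import Literature.Topology.FourManifolds.SphereSurgeryOrientation
import Literature.Topology.FourManifolds.BordismFourComponents
import Literature.Topology.FourManifolds.SignatureBordismInvariance
import HarnessLib

/-!
# The trace of a surgery, IV: orientations — surgery on a connected oriented manifold is an
# oriented bordism

Topic `Literature/Topology/FourManifolds` (fact seat of
`Literature.Topology.FourManifolds.isOrientedBordant_of_isEmpty_of_signature_eq_zero`, Kirby
1989, Cor. IX.2 with VIII Thm 1(A): the bordism `W₁ = M × I ∪ 2-handles` of the printed proof is an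
ORIENTED bordism).  Sequel of `SurgeryTraceTop.lean`.  J. Milnor, *Lectures on the h-cobordism
theorem* (1965), Thm. 3.12 and §3 p. 21 (*"`χ(V, φ)` has a natural orientation"*); J. Milnor,
J. Stasheff, *Characteristic classes* (1974), §17 (oriented bordism `∂W = M ⊔ (−M′)`).

For a CONNECTED closed `ℤ`-oriented `M : Type` of dimension `n + 1` and one framed sphere
`φ : Sᵏ × ℝˡ⁺¹ ↪ M` with `k ≥ 1`, `l ≥ 1` (so that the gluing region `Sᵏ × (B ∖ 0) × (0, 1)` of
the trace is connected), `k + l = n`: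

* `SurgeryTrace.traceNull` — the trace `ω = ω(M, φ)` as a null-cobordism of its own boundary;
  `SurgeryTrace.cylPieceAsPiece` — its cylinder piece as a `NullCobordism.Piece` of the oriented
  cylinder `M × [0, 1]` (`cylinderNull`, `BordismOrientedMerging.lean`); `SurgeryTrace.intLMap` —
  the interior of Milnor's `L` as an open embedding of an open subset of `ℝⁿ⁺²` into the interior
  of `ω`, oriented by the Euclidean orientation;
* `NullCobordism.exists_isRelFundamentalClass_of_piece_of_orientation'` — the gluing theorem of
  `SphereSurgeryOrientation.lean` (Hatcher 2002, p. 253, Lemma 3.27) with its covering hypothesis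
  weakened to the INTERIOR points (verbatim re-run of that proof): `[W_S, ∂W_S]` on a piece and an
  orientation of an open interior piece, overlapping in a nonempty preconnected set, glue to
  `[W_U, ∂W_U]`;
* `SurgeryTrace.exists_isRelFundamentalClass_trace` — **the trace has a relative fundamental
  class** `[ω, ∂ω] ∈ Hₙ₊₂(ω, ∂ω; ℤ)`;
* `SurgeryTrace.exists_isOrientedBordant_trace` — **the oriented statement of Milnor's Thm. 3.12:
  for every `ℤ`-orientation `μ` of `M` there is a `ℤ`-orientation `μ′` of the top end `M′` of the
  trace (a surgery on `M`, `isSurgery_topEnd`) with `IsOrientedBordant (n + 1) μ μ′`** — the boundary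
  orientation of `[ω, ∂ω]` restricted to the two ends (`∂[ω] = [M] + [M′]`, the fundamental class of
  the boundary split along its two open-and-closed halves), with the sign on `M` fixed by the
  dichotomy of orientations of the connected `M`;
* `exists_isSurgery_isOrientedBordant_signature_eq` — **dimension four, Kirby's `W₁ = M × I ∪
  2-handles` one circle at a time (Kirby 1989, proof of VIII Thm 1(A)):** surgery on a framed circle
  `S¹ × D³ ↪ M⁴` in a connected closed `ℤ`-oriented `4`-manifold gives an oriented-bordant
  `(M′, μ′)` with `σ(M′) = σ(M)` (`signature_eq_of_isOrientedBordant_holds`, Thom 1954 Thm IV.1).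

Everything is proved; no named facts.

## References

* J. Milnor, *Lectures on the h-cobordism theorem* (1965), Thm. 3.12, §3 p. 21. [MilnorHCobordism1965]
* J. Milnor, J. Stasheff, *Characteristic classes*, Ann. of Math. Studies 76 (1974), §17.
  [MilnorStasheffAMS76]
* A. Hatcher, *Algebraic Topology* (2002), §3.3 p. 253, Lemma 3.27, Thm. 3.26. [HatcherAT2002]
* R. C. Kirby, *The Topology of 4-Manifolds*, LNM 1374 (1989), Ch. VIII Thm 1(A) (proof), Cor. IX.2.
  [Kirby1989]
-/

noncomputable section

open scoped Manifold ContDiff Topology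
open Set Function Metric Filter CategoryTheory TopologicalSpace Topology
open Literature.AlgebraicTopology.SingularHomology
open Literature.AlgebraicTopology.SingularHomology.SingularSimplex (sumInl sumInr)

namespace Literature.Topology.FourManifolds

/-- Local notation: `𝔼 n` is the model Euclidean space `EuclideanSpace ℝ (Fin n)`. -/
local notation "𝔼 " n:arg => EuclideanSpace ℝ (Fin n)
/-- Local notation: `ℍ n` is the model half-space `EuclideanHalfSpace n`. -/
local notation "ℍ " n:arg => EuclideanHalfSpace n
/-- Local notation: `𝕊 n` is the unit sphere in `EuclideanSpace ℝ (Fin (n + 1))`. -/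
local notation "𝕊 " n:arg => (Metric.sphere (0 : EuclideanSpace ℝ (Fin (n + 1))) 1)

attribute [local instance] fact_finrank_euclideanSpace_succ

/-! ### The gluing theorem with an interior covering hypothesis -/

namespace NullCobordism

variable {m : ℕ}
variable {MU : Type} [TopologicalSpace MU] [ChartedSpace (EuclideanSpace ℝ (Fin (m + 1))) MU]
  [IsManifold (𝓡 (m + 1)) ∞ MU] [CompactSpace MU]
variable {MS : Type} [TopologicalSpace MS] [ChartedSpace (EuclideanSpace ℝ (Fin (m + 1))) MS]
  [IsManifold (𝓡 (m + 1)) ∞ MS] [CompactSpace MS]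
variable {cS : NullCobordism (m + 1) MS} {cU : NullCobordism (m + 1) MU}

/-- **Gluing `[W_S, ∂W_S]` with an orientation of an open oriented interior piece, the two pieces
covering the INTERIOR of `W_U`** (Hatcher 2002, p. 253, Lemma 3.27; Milnor 1965, §3 p. 21): the
theorem `exists_isRelFundamentalClass_of_piece_of_orientation` of `SphereSurgeryOrientation.lean`
with its hypothesis `range S.j ∪ range jT = univ` weakened to interior points (boundary points of
`W_U` outside `range S.j` are allowed); the proof is re-run verbatim, that hypothesis being used
there only at interior points. [cite: HatcherAT2002, §3.3 p. 253, Lemma 3.27] -/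
theorem exists_isRelFundamentalClass_of_piece_of_orientation' (S : Piece cS cU) {B : Type}
    [TopologicalSpace B] [LocallyCompactSpace B] (jT : C(B, cU.W)) (hjT : IsOpenEmbedding jT)
    (hint : ∀ b, jT b ∈ (𝓡∂ (m + 1 + 1)).interior cU.W)
    (μB : HomologicalOrientation ℤ B (m + 1 + 1))
    (hcover : ∀ v : cU.Interior, v.val ∈ range S.j ∨ v.val ∈ range jT)
    (hne : {v : cU.Interior | v.val ∈ range S.j ∩ range jT}.Nonempty)
    (hpre : IsPreconnected {v : cU.Interior | v.val ∈ range S.j ∩ range jT})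
    {wS : relativeSingularHomology ℤ ℤ cS.W ((𝓡∂ (m + 1 + 1)).boundary cS.W) (m + 1 + 1)}
    (hwS : IsRelFundamentalClass ℤ ((𝓡∂ (m + 1 + 1)).boundary cS.W) wS) :
    ∃ wU : relativeSingularHomology ℤ ℤ cU.W ((𝓡∂ (m + 1 + 1)).boundary cU.W) (m + 1 + 1),
      IsRelFundamentalClass ℤ ((𝓡∂ (m + 1 + 1)).boundary cU.W) wU := by
  classical
  set O : Set cU.Interior := {v : cU.Interior | v.val ∈ range S.j ∩ range jT} with hO
  have hOopen : IsOpen O :=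
    (S.isOpenEmbedding_j.isOpen_range.inter hjT.isOpen_range).preimage
      InteriorManifold.continuous_val
  set νS := S.interiorFamily wS with hνS
  set νT := handleInteriorFamily cU jT hjT μB with hνT
  have genS : ∀ v : cU.Interior, v.val ∈ range S.j →
      ∃ e : localHomology ℤ ℤ cU.Interior v (m + 1 + 1) ≃ₗ[ℤ] ℤ, e (νS v) = 1 := by
    rintro v ⟨x, hx⟩
    have hxint := BCSGluing.mem_interior_of_j_eq S hx
    rw [← ModelWithCorners.compl_boundary] at hxint
    exact S.isGenerator_interiorFamily hwS x hxint v hx.symm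
  have genT : ∀ v : cU.Interior, v.val ∈ range jT →
      ∃ e : localHomology ℤ ℤ cU.Interior v (m + 1 + 1) ≃ₗ[ℤ] ℤ, e (νT v) = 1 := by
    rintro v ⟨b, hb⟩
    exact isGenerator_handleInteriorFamily cU jT hjT μB b v hb.symm
  have consS : ∀ v : cU.Interior, v.val ∈ range S.j → ∃ N ∈ 𝓝 v, νS.ConsistentOn N := by
    rintro v ⟨x, hx⟩
    exact S.consistentOn_interiorFamily_nhds wS x (BCSGluing.mem_interior_of_j_eq S hx) v hx.symm
  have consT : ∀ v : cU.Interior, v.val ∈ range jT → ∃ N ∈ 𝓝 v, νT.ConsistentOn N := by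
    rintro v ⟨b, hb⟩
    exact consistentOn_handleInteriorFamily_nhds cU jT hjT μB hint b v hb.symm
  -- the sign function on the overlap and its constancy
  have hsign := fun (v : cU.Interior) (hv : v ∈ O) =>
    exists_units_smul_of_generators (genS v hv.1) (genT v hv.2)
  choose! εf hεf using hsign
  obtain ⟨v₀, hv₀⟩ := hne
  set ε : ℤˣ := εf v₀ with hε
  have hεconst : ∀ v ∈ O, εf v = ε := fun v hv =>
    LocalFamily.sign_eq_of_isPreconnected (EuclideanSpace ℝ (Fin (m + 1 + 1))) (β := νT) (β' := νS)
      hOopen hpre (fun u hu => consT u hu.2) (fun u hu => consS u hu.1)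
      (fun u hu => genT u hu.2) (ε := εf)
      (fun u hu => (hεf u hu).trans (Int.cast_smul_eq_zsmul ℤ (εf u : ℤ) (νT u)).symm) hv hv₀
  -- the glued family
  let β : LocalFamily ℤ ℤ cU.Interior (m + 1 + 1) := fun v =>
    if v.val ∈ range S.j then νS v else (ε : ℤ) • νT v
  have hβS : ∀ v : cU.Interior, v.val ∈ range S.j → β v = νS v := fun v hv => if_pos hv
  have hβT : ∀ v : cU.Interior, v.val ∈ range jT → β v = (ε : ℤ) • νT v := by
    intro v hvT
    by_cases hvS : v.val ∈ range S.j
    · rw [hβS v hvS, hεf v ⟨hvS, hvT⟩, hεconst v ⟨hvS, hvT⟩]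
    · exact if_neg hvS
  have hgen : ∀ v, ∃ e : localHomology ℤ ℤ cU.Interior v (m + 1 + 1) ≃ₗ[ℤ] ℤ, e (β v) = 1 := by
    intro v
    rcases hcover v with hvS | hvT
    · rw [hβS v hvS]; exact genS v hvS
    · rw [hβT v hvT]; exact SmoothOrientation.exists_linearEquiv_units_smul (genT v hvT) ε
  have hcons : ∀ v, ∃ N ∈ 𝓝 v, LocalFamily.ConsistentOn β N := by
    intro v
    by_cases hvS : v.val ∈ range S.j
    · obtain ⟨N, hN, mN, hmN⟩ := consS v hvS
      have hOS : InteriorManifold.val ⁻¹' range S.j ∈ 𝓝 v :=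
        (S.isOpenEmbedding_j.isOpen_range.preimage InteriorManifold.continuous_val).mem_nhds hvS
      refine ⟨N ∩ InteriorManifold.val ⁻¹' range S.j, Filter.inter_mem hN hOS,
        restrictLocal ℤ ℤ inter_subset_left _ mN, fun u hu => ?_⟩
      rw [restrictToPoint_restrictLocal_apply, hmN u hu.1, hβS u hu.2]
    · have hvT : v.val ∈ range jT := (hcover v).resolve_left hvS
      obtain ⟨N, hN, mN, hmN⟩ := consT v hvT
      have hOT : InteriorManifold.val ⁻¹' range jT ∈ 𝓝 v :=
        (hjT.isOpen_range.preimage InteriorManifold.continuous_val).mem_nhds hvT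
      refine ⟨N ∩ InteriorManifold.val ⁻¹' range jT, Filter.inter_mem hN hOT,
        (ε : ℤ) • restrictLocal ℤ ℤ inter_subset_left _ mN, fun u hu => ?_⟩
      rw [map_zsmul, restrictToPoint_restrictLocal_apply, hmN u hu.1, hβT u hu.2]
  set ν := HomologicalOrientation.ofLocalFamily β hgen hcons with hν
  obtain ⟨wU, hwU, -⟩ := cU.exists_isRelFundamentalClass_of_interiorOrientation ν
  exact ⟨wU, hwU⟩

end NullCobordism

namespace SurgeryTrace

open MilnorTrace

variable {n k l : ℕ} {M : Type} [TopologicalSpace M] [ChartedSpace (𝔼 (n + 1)) M]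
  [T2Space M] [IsManifold (𝓡 (n + 1)) ∞ M] [CompactSpace M]
  {ι : Type} [Unique ι] (ν : FramedSphereFamily (𝓡 (n + 1)) M ι k (l + 1)) (hkl : k + l = n)

/-! ### The trace as a null-cobordism of its boundary -/

/-- **The trace as a null-cobordism of its own boundary** (`∂ω` with its boundary-manifold
structure, `incl` the inclusion; Milnor 1965, §1). [cite: MilnorHCobordism1965, §1 Def. 1.1] -/
def traceNull : NullCobordism (n + 1) ↥((𝓡∂ (n + 1 + 1)).boundary (Trace ν hkl)) where
  W := Trace ν hkl
  incl := Subtype.val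
  isSmoothEmbedding_incl := BoundaryManifold.isSmoothEmbedding_subtype_val
  range_incl := Subtype.range_coe

/-- The total space of `traceNull` is the trace. [folklore] -/
@[simp] theorem traceNull_W : (traceNull ν hkl).W = Trace ν hkl := rfl

/-! ### The interior of `L` as an oriented open interior piece -/

/-- The interior `{(‖y‖² - ‖x‖²)² < 1, ‖x‖² ‖y‖² < 2}` of Milnor's `L`, transported to the model
space `ℝⁿ⁺²` along `linF` (an open subset of Euclidean space, hence `ℤ`-oriented). [folklore] -/
def intLOpens : Opens (𝔼 (n + 1 + 1)) :=
  ⟨(linF hkl).symm ⁻¹' {p | levelSq p < 1 ∧ orbit p < 2}, by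
    refine IsOpen.preimage (linF hkl).symm.continuous (IsOpen.inter ?_ ?_)
    · exact isOpen_lt (contDiff_levelSq.continuous) continuous_const
    · exact isOpen_lt continuous_orbit continuous_const⟩

/-- Membership in the transported interior of `L`. [folklore] -/
@[simp] theorem mem_intLOpens {e : 𝔼 (n + 1 + 1)} :
    e ∈ intLOpens hkl ↔ levelSq ((linF hkl).symm e) < 1 ∧ orbit ((linF hkl).symm e) < 2 := Iff.rfl

/-- The point of `L` under a point of the transported interior. [folklore] -/
def intLPt (e : ↥(intLOpens hkl)) : ↥(Lpiece hkl) :=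
  ⟨Slab.mk hkl ((linF hkl).symm e.1) (le_of_lt e.2.1), e.2.2⟩

/-- The underlying model point of `intLPt e`. [folklore] -/
@[simp] theorem val_intLPt (e : ↥(intLOpens hkl)) : ((intLPt hkl e : ↥(Lpiece hkl)) : Slab k l n hkl).val = (linF hkl).symm e.1 := rfl

/-- `intLPt` is injective. [folklore] -/
theorem intLPt_injective : Injective (intLPt (k := k) (l := l) hkl) := by
  intro e e' h
  have h1 := congrArg (fun b : ↥(Lpiece hkl) => (b : Slab k l n hkl).val) h
  simp only [val_intLPt] at h1
  exact Subtype.ext ((linF hkl).symm.injective h1)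

/-- `intLPt` is continuous. [folklore] -/
theorem continuous_intLPt : Continuous (intLPt (k := k) (l := l) hkl) := by
  refine Continuous.subtype_mk ?_ _
  have h : Continuous fun e : ↥(intLOpens hkl) => (linF hkl).symm e.1 :=
    (linF hkl).symm.continuous.comp continuous_subtype_val
  exact (Slab.isEmbedding_val hkl).continuous_iff.2 (by exact h)

/-- `intLPt` is an embedding (its composite with the embedding `val ∘ val` is the embedding
`linF⁻¹ ∘ val`). [folklore] -/
theorem isEmbedding_intLPt : Topology.IsEmbedding (intLPt (k := k) (l := l) hkl) := by
  have h : Topology.IsEmbedding (fun e : ↥(intLOpens hkl) => (linF hkl).symm e.1) :=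
    (linF hkl).symm.toHomeomorph.isEmbedding.comp Topology.IsEmbedding.subtypeVal
  have hcomp : (fun e : ↥(intLOpens hkl) => (linF hkl).symm e.1) =
      (fun b : ↥(Lpiece hkl) => (b : Slab k l n hkl).val) ∘ intLPt hkl := rfl
  rw [hcomp] at h
  exact Topology.IsEmbedding.of_comp (continuous_intLPt hkl)
    ((Slab.continuous_val hkl).comp continuous_subtype_val) h

/-- The range of `intLPt` is the (open) set of points of `L` with `(‖y‖² - ‖x‖²)² < 1`. [folklore] -/
theorem range_intLPt : range (intLPt (k := k) (l := l) hkl) = {b : ↥(Lpiece hkl) | levelSq (b : Slab k l n hkl).val < 1} := by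
  ext b
  constructor
  · rintro ⟨e, rfl⟩
    exact e.2.1
  · intro hb
    refine ⟨⟨linF hkl (b : Slab k l n hkl).val, ?_⟩, ?_⟩
    · show levelSq ((linF hkl).symm (linF hkl (b : Slab k l n hkl).val)) < 1 ∧
        orbit ((linF hkl).symm (linF hkl (b : Slab k l n hkl).val)) < 2
      rw [ContinuousLinearEquiv.symm_apply_apply]
      exact ⟨hb, b.2⟩
    · apply Subtype.ext; apply Slab.ext
      simp

/-- `intLPt` is an open embedding. [folklore] -/
theorem isOpenEmbedding_intLPt : IsOpenEmbedding (intLPt (k := k) (l := l) hkl) := by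
  refine ⟨isEmbedding_intLPt hkl, ?_⟩
  rw [range_intLPt]
  exact isOpen_lt (contDiff_levelSq.continuous.comp ((Slab.continuous_val hkl).comp continuous_subtype_val))
    continuous_const

/-- **The interior of `L` in the trace**: `e ↦ inr (L-point of e)`, a continuous map from the
transported interior of `L` into the trace. [cite: MilnorHCobordism1965, Thm. 3.12, proof] -/
def intLMap : C(↥(intLOpens hkl), (traceNull ν hkl).W) :=
  ⟨fun e => (glueData ν hkl).inr (intLPt hkl e), (glueData ν hkl).continuous_inr.comp (continuous_intLPt hkl)⟩

/-- `intLMap e = inr (intLPt e)`. [folklore] -/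
@[simp] theorem intLMap_apply (e : ↥(intLOpens hkl)) : intLMap ν hkl e = (glueData ν hkl).inr (intLPt hkl e) := rfl

/-- The interior of `L` is openly embedded in the trace. [folklore] -/
theorem isOpenEmbedding_intLMap : IsOpenEmbedding (intLMap ν hkl) :=
  (glueData ν hkl).isOpenEmbedding_inr.comp (isOpenEmbedding_intLPt hkl)

/-- The interior of `L` lies in the interior of the trace (`(‖y‖² - ‖x‖²)² < 1` means off the two
boundary levels). [folklore] -/
theorem intLMap_mem_interior (e : ↥(intLOpens hkl)) :
    intLMap ν hkl e ∈ (𝓡∂ (n + 1 + 1)).interior (traceNull ν hkl).W := by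
  rw [← ModelWithCorners.compl_boundary]
  intro h
  have h' := (isBoundaryPoint_inr_iff ν hkl (intLPt hkl e)).1 h
  rw [← levelSq_eq_one_iff] at h'
  have := e.2.1
  rw [val_intLPt] at h'
  exact absurd h' (ne_of_lt this)

/-- **The Euclidean orientation of the interior of `L`** (an open subset of the `ℤ`-orientable
`ℝⁿ⁺²`, Hatcher 2002, Prop. 3.25; restricted along the open inclusion). [cite: HatcherAT2002, §3.3 Prop. 3.25] -/
def intLOrientation : HomologicalOrientation ℤ ↥(intLOpens hkl) (n + 1 + 1) :=
  (Classical.choice (by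
    obtain ⟨g⟩ : IsOrientableOver ℤ (𝔼 (n + 1 + 1)) (n + 1 + 1) :=
      isOrientableOver_of_simplyConnectedSpace ℤ (𝔼 (n + 1 + 1))
    exact ⟨g⟩) : HomologicalOrientation ℤ (𝔼 (n + 1 + 1)) (n + 1 + 1)).restrictOpens (intLOpens hkl)

/-! ### The overlap `Sᵏ × Sˡ × (0, 1) × (0, 1)` -/

/-- The point `((φ(u, θv), t))` of the cylinder piece over `(u, v, θ, t)`. [folklore] -/
def overlapCylPt (r : (𝕊 k) × (𝕊 l) × (Ioo (0 : ℝ) 1) × (Ioo (0 : ℝ) 1)) : ↥(cylPiece ν) :=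
  ⟨⟨(ν.toFun default (r.1, (r.2.2.1 : ℝ) • (r.2.1 : 𝔼 (l + 1))), (r.2.2.2 : ℝ)),
      Cylinder.mem_carrier_iff.2 ⟨r.2.2.2.2.1.le, r.2.2.2.2.2.le⟩⟩, by
    rw [mem_cylPiece, apply_mem_cores_iff]
    exact smul_ne_zero r.2.2.1.2.1.ne' (ne_zero_of_mem_unit_sphere r.2.1)⟩

omit [IsManifold (𝓡 (n + 1)) ∞ M] [CompactSpace M] in
/-- The underlying pair of `overlapCylPt r`. [folklore] -/
@[simp] theorem coe_coe_overlapCylPt (r : (𝕊 k) × (𝕊 l) × (Ioo (0 : ℝ) 1) × (Ioo (0 : ℝ) 1)) :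
    ((overlapCylPt ν r : ↥(Cylinder.carrier M)) : M × ℝ) =
      (ν.toFun default (r.1, (r.2.2.1 : ℝ) • (r.2.1 : 𝔼 (l + 1))), (r.2.2.2 : ℝ)) := rfl

omit [IsManifold (𝓡 (n + 1)) ∞ M] [CompactSpace M] in
/-- `overlapCylPt` is continuous. [folklore] -/
theorem continuous_overlapCylPt : Continuous (overlapCylPt (k := k) ν) := by
  have hθ : Continuous fun r : (𝕊 k) × (𝕊 l) × (Ioo (0 : ℝ) 1) × (Ioo (0 : ℝ) 1) => (r.2.2.1 : ℝ) := by
    fun_prop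
  have ht : Continuous fun r : (𝕊 k) × (𝕊 l) × (Ioo (0 : ℝ) 1) × (Ioo (0 : ℝ) 1) => (r.2.2.2 : ℝ) := by
    fun_prop
  have hv : Continuous fun r : (𝕊 k) × (𝕊 l) × (Ioo (0 : ℝ) 1) × (Ioo (0 : ℝ) 1) =>
      (r.2.1 : 𝔼 (l + 1)) := by fun_prop
  have h1 : Continuous fun r : (𝕊 k) × (𝕊 l) × (Ioo (0 : ℝ) 1) × (Ioo (0 : ℝ) 1) =>
      ((ν.toFun default (r.1, (r.2.2.1 : ℝ) • (r.2.1 : 𝔼 (l + 1))), (r.2.2.2 : ℝ)) : M × ℝ) :=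
    ((ν.continuous default).comp (continuous_fst.prodMk (hθ.smul hv))).prodMk ht
  exact (h1.subtype_mk _).subtype_mk _

omit [CompactSpace M] in
/-- `inl (overlapCylPt r)` is an interior point of the trace (`0 < t < 1`). [folklore] -/
theorem isInteriorPoint_inl_overlapCylPt (r : (𝕊 k) × (𝕊 l) × (Ioo (0 : ℝ) 1) × (Ioo (0 : ℝ) 1)) :
    (𝓡∂ (n + 1 + 1)).IsInteriorPoint ((glueData ν hkl).inl (overlapCylPt ν r)) := by
  rw [ModelWithCorners.isInteriorPoint_iff_not_isBoundaryPoint]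
  intro hb
  rcases (isBoundaryPoint_inl_iff ν hkl (overlapCylPt ν r)).1 hb with h | h
  · exact r.2.2.2.2.1.ne' h
  · exact r.2.2.2.2.2.ne h

/-- The parametrisation `(u, v, θ, t) ↦ inl ((φ(u, θv), t))` of the interior overlap by
`Sᵏ × Sˡ × (0, 1) × (0, 1)`, with values in the interior manifold of the trace. [folklore] -/
def overlapParam (r : (𝕊 k) × (𝕊 l) × (Ioo (0 : ℝ) 1) × (Ioo (0 : ℝ) 1)) : (traceNull ν hkl).Interior :=
  ⟨(glueData ν hkl).inl (overlapCylPt ν r), isInteriorPoint_inl_overlapCylPt ν hkl r⟩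

/-- The underlying point of `overlapParam r`. [folklore] -/
@[simp] theorem overlapParam_val (r : (𝕊 k) × (𝕊 l) × (Ioo (0 : ℝ) 1) × (Ioo (0 : ℝ) 1)) :
    (overlapParam ν hkl r).val = (glueData ν hkl).inl (overlapCylPt ν r) := rfl

/-- The parametrisation of the overlap is continuous. [folklore] -/
theorem continuous_overlapParam : Continuous (overlapParam ν hkl) :=
  continuous_induced_rng.2 ((glueData ν hkl).continuous_inl.comp (continuous_overlapCylPt ν))

/-! ### The cylinder piece as a `Piece` of the oriented cylinder -/

/-- `inl` of the gluing as a continuous map on the cylinder piece. [folklore] -/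
def inlC : C(↥(cylPiece ν), Trace ν hkl) := ⟨(glueData ν hkl).inl, (glueData ν hkl).continuous_inl⟩

omit [CompactSpace M] in
/-- Boundary points correspond under `inl`: `t = 0, 1` on both sides. [folklore] -/
theorem coe_mem_boundary_iff_inl (a : ↥(cylPiece ν)) :
    (a : ↥(Cylinder.carrier M)) ∈ (𝓡∂ (n + 1 + 1)).boundary ↥(Cylinder.carrier M) ↔
      (glueData ν hkl).inl a ∈ (𝓡∂ (n + 1 + 1)).boundary (Trace ν hkl) := by
  rw [show ((a : ↥(Cylinder.carrier M)) ∈ (𝓡∂ (n + 1 + 1)).boundary ↥(Cylinder.carrier M)) ↔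
      (𝓡∂ (n + 1 + 1)).IsBoundaryPoint (a : ↥(Cylinder.carrier M)) from Iff.rfl,
    Cylinder.isBoundaryPoint_iff (n + 1) M a.1]
  exact (isBoundaryPoint_inl_iff ν hkl a).symm

variable [SecondCountableTopology M]

/-- **The cylinder piece of the trace as a `Piece` of the oriented cylinder `M × [0, 1]`**
(`cylinderNull n M`, a null-cobordism of `M ⊔ M`): openly embedded by `inl`, boundary to boundary
(`t = 0, 1` on both sides). [cite: MilnorHCobordism1965, Thm. 3.12, proof] -/
def cylPieceAsPiece : NullCobordism.Piece (cylinderNull n M) (traceNull ν hkl) where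
  A := cylPiece ν
  j := inlC ν hkl
  isOpenEmbedding_j := (glueData ν hkl).isOpenEmbedding_inl
  mem_boundary_iff x := coe_mem_boundary_iff_inl ν hkl x

/-- The embedding of the cylinder piece is `inl`. [folklore] -/
@[simp] theorem cylPieceAsPiece_j_apply (a : ↥(cylPiece ν)) : (cylPieceAsPiece ν hkl).j a = (glueData ν hkl).inl a := rfl

/-! ### The covering and the overlap -/

/-- **Interior points of the trace are covered by the cylinder piece and the interior of `L`.**
[folklore] -/
theorem interior_cover (v : (traceNull ν hkl).Interior) :
    v.val ∈ range (cylPieceAsPiece ν hkl).j ∨ v.val ∈ range (intLMap ν hkl) := by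
  rcases (glueData ν hkl).exists_inl_or_inr v.val with ⟨a, ha⟩ | ⟨b, hb⟩
  · exact Or.inl ⟨a, ha⟩
  · right
    have hv : v.val ∉ (𝓡∂ (n + 1 + 1)).boundary (Trace ν hkl) := v.val_notMem_boundary
    have hb1 : levelSq (b : Slab k l n hkl).val < 1 := by
      rcases (b.1.levelSq_val_le).lt_or_eq with h | h
      · exact h
      · exfalso
        apply hv
        rw [← hb]
        exact (isBoundaryPoint_inr_iff ν hkl b).2 ((levelSq_eq_one_iff _).1 h)
    have : b ∈ range (intLPt (k := k) (l := l) hkl) := by rw [range_intLPt]; exact hb1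
    obtain ⟨e, rfl⟩ := this
    exact ⟨e, hb⟩

/-- **The interior overlap of the two pieces is the image of `Sᵏ × Sˡ × (0, 1) × (0, 1)`**
(the gluing region at interior times). [cite: MilnorHCobordism1965, Thm. 3.12, proof ("0 < θ < 1")] -/
theorem overlap_eq_range : {v : (traceNull ν hkl).Interior | v.val ∈ range (cylPieceAsPiece ν hkl).j ∩ range (intLMap ν hkl)} =
    range (overlapParam ν hkl) := by
  ext v
  constructor
  · rintro ⟨⟨a, ha⟩, ⟨e, he⟩⟩
    rw [cylPieceAsPiece_j_apply] at ha
    rw [intLMap_apply] at he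
    have hrel := (inl_eq_inr_iff ν hkl a (intLPt hkl e)).1 (ha.trans he.symm)
    obtain ⟨⟨u, w⟩, hw0, hw1, hq⟩ := (mem_pTube_iff ν).1 hrel.1
    have ht : a.1.1.2 ∈ Icc (0 : ℝ) 1 := Cylinder.mem_carrier_iff.1 a.1.2
    -- the level of the glued point is `2t - 1`, strictly between `-1` and `1`
    have hlev : levelSq (fwdPt ν a.1) < 1 := by
      have := e.2.1
      rw [← val_intLPt hkl e, hrel.2] at this
      exact this
    rw [fwdPt, ← hq, tubeHomeo_symm_apply, levelSq, level_fwd (u, w) _ hw0] at hlev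
    have ht0 : 0 < a.1.1.2 := by nlinarith [ht.1, ht.2, hlev]
    have ht1 : a.1.1.2 < 1 := by nlinarith [ht.1, ht.2, hlev]
    have hθ : 0 < ‖w‖ := norm_pos_iff.2 hw0
    refine ⟨(u, radialProjection (spherePt l) w, ⟨‖w‖, hθ, hw1⟩, ⟨a.1.1.2, ht0, ht1⟩), ?_⟩
    apply InteriorManifold.ext
    rw [overlapParam_val, ← ha]
    congr 1
    apply Subtype.ext; apply Subtype.ext
    rw [coe_coe_overlapCylPt]
    show (ν.toFun default (u, ‖w‖ • (radialProjection (spherePt l) w : 𝔼 (l + 1))), a.1.1.2) = a.1.1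
    rw [norm_smul_coe_radialProjection, hq]
  · rintro ⟨r, rfl⟩
    obtain ⟨u, v, ⟨θ, hθ0, hθ1⟩, ⟨t, ht0, ht1⟩⟩ := r
    set a : ↥(cylPiece ν) := overlapCylPt ν (u, v, ⟨θ, hθ0, hθ1⟩, ⟨t, ht0, ht1⟩) with ha
    have hw0 : θ • (v : 𝔼 (l + 1)) ≠ 0 := smul_ne_zero hθ0.ne' (ne_zero_of_mem_unit_sphere v)
    have hmem : a.1.1.1 ∈ pTube ν := by
      show ν.toFun default (u, θ • (v : 𝔼 (l + 1))) ∈ pTube ν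
      rw [apply_mem_pTube_iff, norm_smul_coe_sphere hθ0.le]
      exact ⟨hw0, hθ1⟩
    refine ⟨⟨a, rfl⟩, ?_⟩
    -- the glued point lies in the interior of `L`
    have hlev : levelSq (fwd (u, θ • (v : 𝔼 (l + 1))) (2 * t - 1)) < 1 := by
      rw [levelSq, level_fwd _ _ hw0]
      nlinarith
    have hbval : ((glue ν hkl a : ↥(Lpiece hkl)) : Slab k l n hkl).val = fwd (u, θ • (v : 𝔼 (l + 1))) (2 * t - 1) := by
      rw [glue_apply, val_fwdL_of_mem ν hkl hmem]
      exact fwdPt_apply ν _ t _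
    have hb : glue ν hkl a ∈ range (intLPt (k := k) (l := l) hkl) := by
      rw [range_intLPt, mem_setOf_eq, hbval]; exact hlev
    obtain ⟨e, he⟩ := hb
    refine ⟨e, ?_⟩
    show (glueData ν hkl).inr (intLPt hkl e) = (glueData ν hkl).inl a
    rw [he, ← glueData_glue]
    exact (glueData ν hkl).inr_glue (by rw [glueData_glue, glue_source]; exact hmem)

/-- The interior overlap is nonempty. [folklore] -/
theorem overlap_nonempty :
    {v : (traceNull ν hkl).Interior | v.val ∈ range (cylPieceAsPiece ν hkl).j ∩ range (intLMap ν hkl)}.Nonempty := by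
  rw [overlap_eq_range]
  haveI : Nonempty (Ioo (0 : ℝ) 1) := ⟨⟨2⁻¹, by norm_num, by norm_num⟩⟩
  exact range_nonempty _

omit [T2Space M] [IsManifold (𝓡 (n + 1)) ∞ M] [CompactSpace M] [Unique ι] [SecondCountableTopology M] in
/-- `1 < dim ℝᵐ⁺¹` for `m ≥ 1`. [folklore] -/
theorem one_lt_rank_euclidean {m : ℕ} (hm : 1 ≤ m) : 1 < Module.rank ℝ (𝔼 (m + 1)) := by
  rw [← Module.finrank_eq_rank, finrank_euclideanSpace_fin]
  exact_mod_cast (show 1 < m + 1 by omega)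

/-- **The interior overlap is preconnected for `k ≥ 1`, `l ≥ 1`** (image of the connected
`Sᵏ × Sˡ × (0, 1) × (0, 1)`). [folklore] -/
theorem isPreconnected_overlap (hk : 1 ≤ k) (hl : 1 ≤ l) :
    IsPreconnected {v : (traceNull ν hkl).Interior | v.val ∈ range (cylPieceAsPiece ν hkl).j ∩ range (intLMap ν hkl)} := by
  rw [overlap_eq_range]
  haveI : PreconnectedSpace (𝕊 k) :=
    isPreconnected_iff_preconnectedSpace.1 (isPreconnected_sphere (one_lt_rank_euclidean hk) (0 : 𝔼 (k + 1)) 1)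
  haveI : PreconnectedSpace (𝕊 l) :=
    isPreconnected_iff_preconnectedSpace.1 (isPreconnected_sphere (one_lt_rank_euclidean hl) (0 : 𝔼 (l + 1)) 1)
  haveI : PreconnectedSpace (Ioo (0 : ℝ) 1) := isPreconnected_iff_preconnectedSpace.1 isPreconnected_Ioo
  exact isPreconnected_range (continuous_overlapParam ν hkl)

/-! ### The relative fundamental class of the trace -/

/-- **The trace of a surgery on a connected closed oriented manifold has a relative fundamental
class** (`k ≥ 1`, `l ≥ 1`): glue `[M × I, ∂]` (the cylinder over the connected oriented `M`,
`exists_isRelFundamentalClass_cylinderNull`) restricted to the cylinder piece with the Euclidean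
orientation of the interior of `L`, along the connected gluing region (Milnor 1965, §3 p. 21;
Hatcher 2002, p. 253). [cite: MilnorHCobordism1965, Thm. 3.12 and §3 (PDF p. 21)] -/
theorem exists_isRelFundamentalClass_trace [ConnectedSpace M] (hk : 1 ≤ k) (hl : 1 ≤ l)
    (μ : HomologicalOrientation ℤ M (n + 1)) :
    ∃ wU : relativeSingularHomology ℤ ℤ (Trace ν hkl) ((𝓡∂ (n + 1 + 1)).boundary (Trace ν hkl)) (n + 1 + 1),
      IsRelFundamentalClass ℤ ((𝓡∂ (n + 1 + 1)).boundary (Trace ν hkl)) wU := by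
  haveI : Nonempty M := ConnectedSpace.toNonempty
  haveI : LocallyCompactSpace ↥(intLOpens hkl) := (intLOpens hkl).isOpen.locallyCompactSpace
  obtain ⟨wS, hwS, -⟩ := exists_isRelFundamentalClass_cylinderNull (n := n) (A := M) μ
  have h := NullCobordism.exists_isRelFundamentalClass_of_piece_of_orientation'
    (cS := cylinderNull n M) (cU := traceNull ν hkl) (cylPieceAsPiece ν hkl)
    (intLMap ν hkl) (isOpenEmbedding_intLMap ν hkl) (intLMap_mem_interior ν hkl) (intLOrientation hkl)
    (interior_cover ν hkl) (overlap_nonempty ν hkl) (isPreconnected_overlap ν hkl hk hl) hwS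
  exact h

/-! ### Splitting the fundamental class of a closed manifold along complementary opens -/

omit [T2Space M] [IsManifold (𝓡 (n + 1)) ∞ M] [CompactSpace M] [Unique ι] [SecondCountableTopology M] in
/-- **The fundamental class of a closed oriented manifold splits along complementary open
subsets**: `[X]_θ = (ι_U)_* [U]_{θ|U} + (ι_V)_* [V]_{θ|V}` (`U ⊔ V ≅ X`,
`exists_diffeomorph_sum_of_isCompl`; the orientation transported to `U ⊔ V` is the sum
orientation, `comap_localClass_inl/inr_eq_map_restrictOpens`; `[U ⊔ V] = inl_*[U] + inr_*[V]`,
`fundamentalClass_sum`; Hatcher 2002, Thm. 3.26, Lemma 3.27). [cite: HatcherAT2002, §3.3 Thm. 3.26 and Lemma 3.27] -/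
theorem fundamentalClass_eq_of_isCompl {d : ℕ} {X : Type} [TopologicalSpace X] [T2Space X]
    [ChartedSpace (𝔼 d) X] [IsManifold (𝓡 d) ∞ X] [CompactSpace X]
    (θ : HomologicalOrientation ℤ X d) (U V : Opens X) [CompactSpace U] [CompactSpace V]
    (hUV : IsCompl (U : Set X) V) :
    θ.fundamentalClass =
      singularHomology.map ℤ ℤ (HomologicalOrientation.valC U) d (θ.restrictOpens U).fundamentalClass +
        singularHomology.map ℤ ℤ (HomologicalOrientation.valC V) d (θ.restrictOpens V).fundamentalClass := by
  obtain ⟨φ, hφ⟩ := exists_diffeomorph_sum_of_isCompl (k := d) (M := X) U V hUV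
  set e : (U ⊕ V) ≃ₜ X := φ.toHomeomorph with he
  have heφ : ∀ p, e p = Sum.elim Subtype.val Subtype.val p := hφ
  have h₁ := comap_localClass_inl_eq_map_restrictOpens θ U V e heφ
  have h₂ := comap_localClass_inr_eq_map_restrictOpens θ U V e heφ
  have hsum := HomologicalOrientation.fundamentalClass_sum ℤ (θ.restrictOpens U) (θ.restrictOpens V) (θ.comap e) h₁ h₂
  have hc := HomologicalOrientation.fundamentalClass_comap_holds (R := ℤ) (X := X) (Y := U ⊕ V) d θ e
  have hU : (e : C(U ⊕ V, X)).comp (sumInl U V) = HomologicalOrientation.valC U :=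
    ContinuousMap.ext fun u => heφ _
  have hV : (e : C(U ⊕ V, X)).comp (sumInr U V) = HomologicalOrientation.valC V :=
    ContinuousMap.ext fun v => heφ _
  have key : θ.fundamentalClass = singularHomology.map ℤ ℤ (e : C(U ⊕ V, X)) d (θ.comap e).fundamentalClass := by
    rw [hc, singularHomology.mapIso_inv, ← ModuleCat.comp_apply, ← singularHomology.map_comp]
    have : (e : C(U ⊕ V, X)).comp ((e.symm : X ≃ₜ (U ⊕ V)) : C(X, U ⊕ V)) = ContinuousMap.id X :=
      ContinuousMap.ext fun x => e.apply_symm_apply x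
    rw [this, singularHomology.map_id]
    rfl
  rw [key, hsum, map_add, ← ModuleCat.comp_apply, ← singularHomology.map_comp, hU, ← ModuleCat.comp_apply,
    ← singularHomology.map_comp, hV]

/-! ### The oriented trace -/

omit [CompactSpace M] [SecondCountableTopology M] in
/-- The two ends are complementary open subsets of the boundary of the trace. [folklore] -/
theorem isCompl_botEnd_topEnd :
    IsCompl ((botEnd ν hkl : Opens ↥((𝓡∂ (n + 1 + 1)).boundary (Trace ν hkl))) :
      Set ↥((𝓡∂ (n + 1 + 1)).boundary (Trace ν hkl))) (topEnd ν hkl) := by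
  refine IsCompl.of_eq ?_ ?_
  · ext y
    simp only [Set.inf_eq_inter, mem_inter_iff, SetLike.mem_coe, Set.bot_eq_empty, mem_empty_iff_false,
      iff_false, not_and]
    intro h1 h2
    have e1 := (mem_botEnd_iff ν hkl).1 h1
    have e2 := (mem_topEnd_iff ν hkl).1 h2
    rw [e1] at e2
    norm_num at e2
  · ext y
    simp only [Set.sup_eq_union, mem_union, SetLike.mem_coe, Set.top_eq_univ, mem_univ, iff_true]
    rcases traceHeight_eq_or_of_mem_boundary ν hkl y.2 with h | h
    · exact Or.inl ((mem_botEnd_iff ν hkl).2 h)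
    · exact Or.inr ((mem_topEnd_iff ν hkl).2 h)

omit [CompactSpace M] [SecondCountableTopology M] in
/-- The bottom end is closed in the boundary (height `= -1`). [folklore] -/
theorem isClosed_botEnd : IsClosed (botEnd ν hkl : Set ↥((𝓡∂ (n + 1 + 1)).boundary (Trace ν hkl))) := by
  have : (botEnd ν hkl : Set ↥((𝓡∂ (n + 1 + 1)).boundary (Trace ν hkl))) =
      {y | traceHeight ν hkl y.1 = -1} := Set.ext fun y => mem_botEnd_iff ν hkl
  rw [this]
  exact isClosed_eq ((continuous_traceHeight ν hkl).comp continuous_subtype_val) continuous_const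

/-- The bottom end is compact. [folklore] -/
instance compactSpace_botEnd : CompactSpace ↥(botEnd ν hkl) :=
  isCompact_iff_compactSpace.1 (isClosed_botEnd ν hkl).isCompact

omit [SecondCountableTopology M] in
/-- The incoming end of the trace cobordism, into the boundary: the inclusion of the bottom end
after `botDiffeo`. [folklore] -/
theorem inlBoundary_traceCobordism_eq :
    (traceCobordism ν hkl).inlBoundary =
      (HomologicalOrientation.valC (botEnd ν hkl)).comp
        ⟨botDiffeo ν hkl, (botDiffeo ν hkl).continuous⟩ :=
  ContinuousMap.ext fun _ => Subtype.ext rfl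

omit [SecondCountableTopology M] in
/-- The outgoing end of the trace cobordism, into the boundary: the inclusion of the top end.
[folklore] -/
theorem inrBoundary_traceCobordism_eq :
    (traceCobordism ν hkl).inrBoundary = HomologicalOrientation.valC (topEnd ν hkl) :=
  ContinuousMap.ext fun _ => Subtype.ext rfl

/-- **The oriented trace (Milnor 1965, Thm. 3.12 with §3 p. 21; Milnor–Stasheff 1974, §17): for a
connected closed `ℤ`-oriented `(M, μ)` and a framed sphere of type `(k + 1, l + 1)`, `k, l ≥ 1`,
the top end `M′` of the trace (a surgery on `M`, `isSurgery_topEnd`) carries a `ℤ`-orientation `μ′`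
with `(M, μ)` oriented-bordant to `(M′, μ′)` through the trace.**  Proof: a relative fundamental
class `[ω, ∂ω]` (`exists_isRelFundamentalClass_trace`) has `∂[ω, ∂ω] = [∂ω]_θ` for its boundary
orientation `θ` (`boundaryOrientation_fundamentalClass_eq`), which splits along the two ends
(`fundamentalClass_eq_of_isCompl`) as `(inl)_*[M]_{θ₀} + (inr)_*[M′]_{θ|M′}` with `θ₀` the bottom
orientation transported to `M` by `botDiffeo`; so `(M, θ₀) ∼ (M′, −θ|M′)`, and `θ₀ = ±μ` on the
connected `M` (`eq_or_eq_neg_of_connected_holds`, `IsOrientedBordant.neg`).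
[cite: MilnorHCobordism1965, Thm. 3.12 and §3 (PDF p. 21)] -/
theorem exists_isOrientedBordant_trace [ConnectedSpace M] (hk : 1 ≤ k) (hl : 1 ≤ l)
    (μ : HomologicalOrientation ℤ M (n + 1)) :
    ∃ μ' : HomologicalOrientation ℤ ↥(topEnd ν hkl) (n + 1), IsOrientedBordant (n + 1) μ μ' := by
  obtain ⟨wU, hwU⟩ := exists_isRelFundamentalClass_trace ν hkl hk hl μ
  -- the boundary orientation `θ`, kept opaque (only its fundamental class matters)
  obtain ⟨θ, hθ⟩ : ∃ θ : HomologicalOrientation ℤ ↥((𝓡∂ (n + 1 + 1)).boundary (Trace ν hkl)) (n + 1),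
      θ.fundamentalClass =
        relativeSingularHomology.δ ℤ ℤ (Trace ν hkl) ((𝓡∂ (n + 1 + 1)).boundary (Trace ν hkl)) (n + 1) wU :=
    ⟨_, boundaryOrientation_fundamentalClass_eq ℤ n.succ_ne_zero hwU⟩
  have hsplit := fundamentalClass_eq_of_isCompl θ (botEnd ν hkl) (topEnd ν hkl) (isCompl_botEnd_topEnd ν hkl)
  -- the bottom orientation transported to `M`, kept opaque as well
  obtain ⟨θ₀, hbot⟩ : ∃ θ₀ : HomologicalOrientation ℤ M (n + 1),
      singularHomology.map ℤ ℤ (⟨botDiffeo ν hkl, (botDiffeo ν hkl).continuous⟩ : C(M, ↥(botEnd ν hkl))) (n + 1)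
        θ₀.fundamentalClass = (θ.restrictOpens (botEnd ν hkl)).fundamentalClass := by
    refine ⟨(θ.restrictOpens (botEnd ν hkl)).comap (botDiffeo ν hkl).toHomeomorph, ?_⟩
    rw [HomologicalOrientation.fundamentalClass_comap_holds (R := ℤ) (X := ↥(botEnd ν hkl)) (Y := M) (n + 1)
      _ (botDiffeo ν hkl).toHomeomorph, singularHomology.mapIso_inv, ← ModuleCat.comp_apply,
      ← singularHomology.map_comp]
    have : (⟨botDiffeo ν hkl, (botDiffeo ν hkl).continuous⟩ : C(M, ↥(botEnd ν hkl))).comp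
        (((botDiffeo ν hkl).toHomeomorph.symm : ↥(botEnd ν hkl) ≃ₜ M) : C(↥(botEnd ν hkl), M)) =
          ContinuousMap.id _ :=
      ContinuousMap.ext fun y => (botDiffeo ν hkl).toHomeomorph.apply_symm_apply y
    rw [this, singularHomology.map_id]
    rfl
  have e1 : singularHomology.map ℤ ℤ (traceCobordism ν hkl).inlBoundary (n + 1) θ₀.fundamentalClass =
      singularHomology.map ℤ ℤ (HomologicalOrientation.valC (botEnd ν hkl)) (n + 1)
        (θ.restrictOpens (botEnd ν hkl)).fundamentalClass := by
    have h := congrArg (fun z => singularHomology.map ℤ ℤ (HomologicalOrientation.valC (botEnd ν hkl)) (n + 1) z) hbot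
    simp only at h
    rw [← ModuleCat.comp_apply, ← singularHomology.map_comp, ← inlBoundary_traceCobordism_eq] at h
    exact h
  have e2 : singularHomology.map ℤ ℤ (traceCobordism ν hkl).inrBoundary (n + 1)
        (θ.restrictOpens (topEnd ν hkl)).fundamentalClass =
      singularHomology.map ℤ ℤ (HomologicalOrientation.valC (topEnd ν hkl)) (n + 1)
        (θ.restrictOpens (topEnd ν hkl)).fundamentalClass :=
    congrArg (fun f : C(↥(topEnd ν hkl), ↥((𝓡∂ (n + 1 + 1)).boundary (Trace ν hkl))) =>
      singularHomology.map ℤ ℤ f (n + 1) (θ.restrictOpens (topEnd ν hkl)).fundamentalClass)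
      (inrBoundary_traceCobordism_eq ν hkl)
  have hδ : relativeSingularHomology.δ ℤ ℤ (Trace ν hkl) ((𝓡∂ (n + 1 + 1)).boundary (Trace ν hkl)) (n + 1) wU =
      singularHomology.map ℤ ℤ (traceCobordism ν hkl).inlBoundary (n + 1) θ₀.fundamentalClass +
        singularHomology.map ℤ ℤ (traceCobordism ν hkl).inrBoundary (n + 1)
          (θ.restrictOpens (topEnd ν hkl)).fundamentalClass :=
    hθ.symm.trans (hsplit.trans (congrArg₂ (· + ·) e1 e2).symm)
  have hδ' : relativeSingularHomology.δ ℤ ℤ (Trace ν hkl) ((𝓡∂ (n + 1 + 1)).boundary (Trace ν hkl)) (n + 1) wU =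
      singularHomology.map ℤ ℤ (traceCobordism ν hkl).inlBoundary (n + 1) θ₀.fundamentalClass -
        singularHomology.map ℤ ℤ (traceCobordism ν hkl).inrBoundary (n + 1)
          (-(θ.restrictOpens (topEnd ν hkl))).fundamentalClass := by
    have hneg : (-(θ.restrictOpens (topEnd ν hkl))).fundamentalClass =
        -(θ.restrictOpens (topEnd ν hkl)).fundamentalClass :=
      HomologicalOrientation.fundamentalClass_neg_holds (R := ℤ) (X := ↥(topEnd ν hkl)) (n + 1) _
    simpa only [hneg, map_neg, sub_neg_eq_add] using hδ
  have hbord : IsOrientedBordant (n + 1) θ₀ (-(θ.restrictOpens (topEnd ν hkl))) :=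
    ⟨traceCobordism ν hkl, wU, hδ'⟩
  rcases HomologicalOrientation.eq_or_eq_neg_of_connected_holds M μ θ₀ with rfl | rfl
  · exact ⟨_, hbord⟩
  · exact ⟨_, hbord.neg
      (HomologicalOrientation.fundamentalClass_neg_holds (R := ℤ) (X := M) (n + 1))
      (HomologicalOrientation.fundamentalClass_neg_holds (R := ℤ) (X := ↥(topEnd ν hkl)) (n + 1))⟩

include hkl in
/-- **Oriented surgery: a connected closed `ℤ`-oriented manifold is oriented-bordant to a manifold
obtained from it by surgery** along any framed sphere of type `(k + 1, l + 1)` with `k, l ≥ 1`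
(Milnor 1965, Thm. 3.12; Kervaire–Milnor 1963, §5; Milnor–Stasheff 1974, §17).
[cite: MilnorHCobordism1965, Thm. 3.12 and §3 (PDF p. 21)] -/
theorem exists_isSurgery_isOrientedBordant [ConnectedSpace M] (hk : 1 ≤ k) (hl : 1 ≤ l)
    (μ : HomologicalOrientation ℤ M (n + 1)) :
    ∃ (M' : Type) (_ : TopologicalSpace M') (_ : ChartedSpace (𝔼 (n + 1)) M')
      (_ : IsManifold (𝓡 (n + 1)) ∞ M') (_ : CompactSpace M') (_ : T2Space M') (_ : SecondCountableTopology M')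
      (μ' : HomologicalOrientation ℤ M' (n + 1)),
      ν.IsSurgery (𝓡 (n + 1)) M' ∧ IsOrientedBordant (n + 1) μ μ' := by
  obtain ⟨μ', h⟩ := exists_isOrientedBordant_trace ν hkl hk hl μ
  exact ⟨↥(topEnd ν hkl), inferInstance, inferInstance, inferInstance, inferInstance, inferInstance,
    inferInstance, μ', isSurgery_topEnd ν hkl, h⟩

end SurgeryTrace

/-! ### §8 Dimension four: Kirby's `W₁` step, one circle at a time -/

/-- **Kirby 1989, VIII Thm 1(A), proof ("`W₁ = M × I ∪ 2-handles`"), per circle:** surgery on one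
framed circle `S¹ × D³ ↪ M` in a connected closed smooth `ℤ`-oriented `4`-manifold `(M, μ)` yields
a closed smooth `4`-manifold `M′` which is a surgery on `M` along it, with a `ℤ`-orientation `μ′`
such that `(M, μ)` and `(M′, μ′)` are oriented-bordant (through the trace `M × I ∪ D² × D³`,
Milnor 1965 Thm 3.12, `SurgeryTrace.exists_isSurgery_isOrientedBordant` with `n = 3`, `k = 1`,
`l = 2`) and therefore, by the bordism invariance of the signature (Thom 1954 Thm IV.1,
`signature_eq_of_isOrientedBordant_holds`), `σ(M′, μ′) = σ(M, μ)`.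
[cite: Kirby1989, Ch. VIII Thm 1(A) (proof)] -/
theorem exists_isSurgery_isOrientedBordant_signature_eq {M : Type} [TopologicalSpace M]
    [ChartedSpace (𝔼 4) M] [T2Space M] [SecondCountableTopology M] [CompactSpace M]
    [IsManifold (𝓡 4) ∞ M] [ConnectedSpace M] {ι : Type} [Unique ι]
    (ν : FramedSphereFamily (𝓡 4) M ι 1 3) (μ : HomologicalOrientation ℤ M 4) :
    ∃ (M' : Type) (_ : TopologicalSpace M') (_ : ChartedSpace (𝔼 4) M')
      (_ : IsManifold (𝓡 4) ∞ M') (_ : CompactSpace M') (_ : T2Space M') (_ : SecondCountableTopology M')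
      (μ' : HomologicalOrientation ℤ M' 4),
      ν.IsSurgery (𝓡 4) M' ∧ IsOrientedBordant 4 μ μ' ∧ μ'.signature = μ.signature := by
  obtain ⟨M', i₁, i₂, i₃, i₄, i₅, i₆, μ', hs, hb⟩ :=
    SurgeryTrace.exists_isSurgery_isOrientedBordant (n := 3) (k := 1) (l := 2) ν rfl le_rfl one_le_two μ
  have hσ : μ.signature = μ'.signature := signature_eq_of_isOrientedBordant_holds μ μ' hb
  exact ⟨M', i₁, i₂, i₃, i₄, i₅, i₆, μ', hs, hb, hσ.symm⟩

end Literature.Topology.FourManifolds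

end
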